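import Summits.HodgeConjecture.CorCM.TwoGroupCentraliserWords
import Summits.HodgeConjecture.CorCM.TwoGroupTwoConjugateInvolution
import HarnessLib

/-!
# Case A of the order-`32` base: the normal form of family IA8 (`C(t) = C₈ × C₂`)

COR-CM (cell `pub-hodgecm2`), binder seat b04 (gen 37), count-neutral own lane «Galois-CM-type classification».  KERNEL ONLY:
theorems; no definition, no named fact, no `sorry`.  Pure group theory (A7-JUNCTION gen-36 addendum §G (b), gen-37 addendum).
`|G| = 32`, `c` the ONLY central involution, `g⁴ ∈ {1, c}` for all `g`; `t ∉ {1, c}` an involution with `x t x⁻¹ = tc` and all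
conjugates in `{t, tc}` (so `M = C(t)` has index `2`); `a ∈ M` with `a² ∉ N = {1, t, c, tc}`.

* `pow_four_eq_of_sq_not_mem` — then `a⁴ = c` (if `a⁴ = 1`, `M = ⟨a⟩ × ⟨t⟩ × ⟨c⟩` is abelian with squares `{1, a²}`, and
  `x a² x⁻¹ = (x a x⁻¹)² = a²`: the involution `a²` would be central).
* `ia8_normal_form` — hence `a` has order `8`, `M = ⟨a⟩ × ⟨t⟩`, `x a x⁻¹ = a^μ` (the `t`-component vanishes because `x²`
  centralises `a`), `x² = a^σ t^τ`, and `(μ, σ, τ)` is one of the `24` admissible triples of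
  `CorCM/GaloisThirtyTwoCyclicEightTimesTwoCertificates` (`μ` odd, `(μ - 1)σ ≡ 4τ`): exactly the hypotheses of
  `exists_simple_degenerate_of_c8c2_action`.

## References

* [Rotman1995] J. J. Rotman, *An Introduction to the Theory of Groups*, 4th ed., GTM 148, Ch. 4 Ex. 4.4, Cor. 5.45.
-/

namespace Summit.HodgeConjecture.CorCM.GaloisModels.CaseA

open Summit.HodgeConjecture.CorCM.GaloisTableLaws (zmod2_cases pow_eq_pow_of_mod_eq)

variable {G : Type*} [Group G] [Finite G]

/-! ## §1 Conjugates by `x` stay in `C(t)` -/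

omit [Finite G] in
/-- If `a` commutes with `t` and with the central `c`, and `x⁻¹ t x ∈ {t, tc}`, then `x a x⁻¹` commutes with `t`. [folklore] -/
theorem conj_comm_of_comm {t c x a : G} (hcen : ∀ g : G, c * g = g * c)
    (hconj : ∀ g : G, g * t * g⁻¹ = t ∨ g * t * g⁻¹ = t * c) (hat : a * t = t * a) :
    x * a * x⁻¹ * t = t * (x * a * x⁻¹) := by
  -- `s = x⁻¹ t x` commutes with `a`
  have hs : a * (x⁻¹ * t * x) = (x⁻¹ * t * x) * a := by
    rcases hconj x⁻¹ with h | h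
    · rw [inv_inv] at h; rw [h, hat]
    · rw [inv_inv] at h
      rw [h, ← mul_assoc, hat, mul_assoc, ← hcen a, mul_assoc]
  calc x * a * x⁻¹ * t = x * (a * (x⁻¹ * t * x)) * x⁻¹ := by group
    _ = x * ((x⁻¹ * t * x) * a) * x⁻¹ := by rw [hs]
    _ = t * (x * a * x⁻¹) := by group

omit [Finite G] in
/-- `x t x⁻¹ = t c` with `c` a central involution ⟹ `x²` commutes with `t`. [folklore] -/
theorem sq_comm_of_conj {t c x : G} (hcc : c * c = 1) (hcen : ∀ g : G, c * g = g * c) (hxt : x * t * x⁻¹ = t * c) :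
    x * x * t = t * (x * x) := by
  have h1 : x * t = t * c * x := by rw [← hxt]; group
  calc x * x * t = x * (x * t) := mul_assoc _ _ _
    _ = x * (t * c * x) := by rw [h1]
    _ = (x * t) * (c * x) := by group
    _ = (t * c * x) * (c * x) := by rw [h1]
    _ = t * (c * (x * c) * x) := by group
    _ = t * (c * (c * x) * x) := by rw [hcen x]
    _ = t * (x * x) := by rw [← mul_assoc c c, hcc, one_mul]

/-! ## §2 `a² ∉ N ⟹ a⁴ = c` -/

/-- **`a ∈ C(t)` with `a² ∉ {1, t, c, tc}` has `a⁴ = c`** (case A, `g⁴ ∈ {1, c}`). [cite: Rotman1995, Ch. 4 Ex. 4.4] -/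
theorem pow_four_eq_of_sq_not_mem (hcard : Nat.card G = 32) {t c x a : G} (hcc : c * c = 1) (hc1 : c ≠ 1)
    (hcen : ∀ g : G, c * g = g * c) (huci : ∀ s : G, s * s = 1 → (∀ g : G, g * s = s * g) → s = 1 ∨ s = c)
    (hp4 : ∀ g : G, g ^ 4 = 1 ∨ g ^ 4 = c) (hxt : x * t * x⁻¹ = t * c)
    (hconj : ∀ g : G, g * t * g⁻¹ = t ∨ g * t * g⁻¹ = t * c) (htt : t * t = 1) (ht1 : t ≠ 1) (htne : t ≠ c)
    (hat : a * t = t * a) (hsq : a * a ≠ 1 ∧ a * a ≠ t ∧ a * a ≠ c ∧ a * a ≠ t * c) : a ^ 4 = c := by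
  classical
  rcases hp4 a with h4 | h4
  · exfalso
    haveI : Fact (Nat.Prime 2) := ⟨Nat.prime_two⟩
    have ha : orderOf a = 4 := by
      have h1 : ¬ a ^ 2 ^ 1 = 1 := by rw [pow_one, pow_two]; exact hsq.1
      have h2 : a ^ 2 ^ (1 + 1) = 1 := by simpa using h4
      simpa using orderOf_eq_prime_pow h1 h2
    have henum := exists_word_four hcard hcc hc1 hcen hxt hconj htt ht1 htne ha hat ⟨hsq.2.1, hsq.2.2.1, hsq.2.2.2⟩
    -- every element of `C(t)` commutes with `a`
    have hMa : ∀ m : G, m * t = t * m → m * a = a * m := by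
      intro m hm
      obtain ⟨i, j, k, rfl⟩ := henum m hm
      exact ((((Commute.refl a).pow_left _).mul_left ((show Commute t a from hat.symm).pow_left _)).mul_left
        ((show Commute c a from hcen a).pow_left _)).eq
    -- `x a x⁻¹ ∈ C(t)`, so `(x a x⁻¹)² = x a² x⁻¹ ∈ {1, a²}`
    obtain ⟨i, j, k, hijk⟩ := henum _ (conj_comm_of_comm (x := x) hcen hconj hat)
    have hsq2 : x * (a * a) * x⁻¹ = a ^ (2 * i.val) := by
      calc x * (a * a) * x⁻¹ = (x * a * x⁻¹) * (x * a * x⁻¹) := by group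
        _ = (a ^ i.val * t ^ j.val * c ^ k.val) * (a ^ i.val * t ^ j.val * c ^ k.val) := by rw [hijk]
        _ = a ^ i.val * a ^ i.val * (t ^ j.val * c ^ k.val * (t ^ j.val * c ^ k.val)) := by
            have hc : (t ^ j.val * c ^ k.val) * a ^ i.val = a ^ i.val * (t ^ j.val * c ^ k.val) :=
              (((show Commute t a from hat.symm).pow_pow _ _).mul_left ((show Commute c a from hcen a).pow_pow _ _)).eq
            calc (a ^ i.val * t ^ j.val * c ^ k.val) * (a ^ i.val * t ^ j.val * c ^ k.val)
                = a ^ i.val * ((t ^ j.val * c ^ k.val) * a ^ i.val) * (t ^ j.val * c ^ k.val) := by group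
              _ = a ^ i.val * (a ^ i.val * (t ^ j.val * c ^ k.val)) * (t ^ j.val * c ^ k.val) := by rw [hc]
              _ = a ^ i.val * a ^ i.val * (t ^ j.val * c ^ k.val * (t ^ j.val * c ^ k.val)) := by group
        _ = a ^ (2 * i.val) := by
            rw [invol_word_mul htt hcc (hcen t).symm, show (j + j).val = 0 by rcases zmod2_cases j with rfl | rfl <;> rfl,
              show (k + k).val = 0 by rcases zmod2_cases k with rfl | rfl <;> rfl, pow_zero, pow_zero, mul_one, mul_one,
              ← pow_add, two_mul]
    have hxv : x * (a * a) = a * a * x := by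
      rcases Nat.even_or_odd i.val with ⟨r, hr⟩ | ⟨r, hr⟩
      · exfalso
        rw [hr, show 2 * (r + r) = 4 * r by ring, pow_mul, h4, one_pow, mul_inv_eq_one, mul_eq_left] at hsq2
        exact hsq.1 hsq2
      · rw [hr, show 2 * (2 * r + 1) = 4 * r + 2 by ring, pow_add, pow_mul, h4, one_pow, one_mul, pow_two,
          mul_inv_eq_iff_eq_mul] at hsq2
        exact hsq2
    -- `v = a²` is central
    have hidx := index_centralizer_eq_two_of_conj hc1 hxt hconj
    have hmemC : ∀ g : G, g ∈ Subgroup.centralizer ({t} : Set G) ↔ g * t = t * g := fun g =>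
      Subgroup.mem_centralizer_singleton_iff
    have hxC : x ∉ Subgroup.centralizer ({t} : Set G) := by
      rw [hmemC]
      intro h
      have : x * t * x⁻¹ = t := by rw [h]; group
      rw [this] at hxt
      exact hc1 (mul_left_cancel (hxt.symm.trans (mul_one t).symm))
    have hcent : ∀ g : G, g * (a * a) = a * a * g := by
      intro g
      by_cases hg : g * t = t * g
      · have h := hMa g hg
        rw [← mul_assoc, h, mul_assoc, h, mul_assoc]
      · have hk : x⁻¹ * g ∈ Subgroup.centralizer ({t} : Set G) := by
          rw [Subgroup.mul_mem_iff_of_index_two hidx]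
          exact ⟨fun h => absurd (by simpa using h) hxC, fun h => absurd ((hmemC g).1 h) hg⟩
        have h := hMa _ ((hmemC _).1 hk)
        have hk2 : (x⁻¹ * g) * (a * a) = a * a * (x⁻¹ * g) := by rw [← mul_assoc, h, mul_assoc, h, ← mul_assoc]
        calc g * (a * a) = x * ((x⁻¹ * g) * (a * a)) := by group
          _ = x * (a * a * (x⁻¹ * g)) := by rw [hk2]
          _ = (x * (a * a)) * (x⁻¹ * g) := by group
          _ = (a * a * x) * (x⁻¹ * g) := by rw [hxv]
          _ = a * a * g := by group
    have hvv : a * a * (a * a) = 1 := by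
      rw [show a * a * (a * a) = a ^ 4 by simp only [pow_succ, pow_zero, one_mul, mul_assoc]]; exact h4
    rcases huci (a * a) hvv hcent with h | h
    · exact hsq.1 h
    · exact hsq.2.2.1 h
  · exact h4

/-! ## §3 The normal form -/

/-- The admissible parameters: `μ` odd (`4μ = 4`) and `μσ + 4τ = σ`. [folklore] -/
theorem c8c2_admissible_of_eq : ∀ (μ σ : ZMod 8) (τ : ZMod 2), 4 * μ = 4 → μ * σ + 4 * (τ.val : ZMod 8) = σ →
    (μ, σ, τ) ∈ ([(1, 0, 0), (1, 1, 0), (1, 2, 0), (1, 3, 0), (1, 4, 0), (1, 5, 0), (1, 6, 0), (1, 7, 0), (3, 0, 0), (3, 2, 1),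
      (3, 4, 0), (3, 6, 1), (5, 0, 0), (5, 1, 1), (5, 2, 0), (5, 3, 1), (5, 4, 0), (5, 5, 1), (5, 6, 0), (5, 7, 1), (7, 0, 0),
      (7, 2, 1), (7, 4, 0), (7, 6, 1)] : List (ZMod 8 × ZMod 8 × ZMod 2)) := by
  decide

/-- **Normal form of family IA8.**  `|G| = 32`, `c` the only central involution, `g⁴ ∈ {1, c}` for all `g`; `t ∉ {1, c}` an
involution with `x t x⁻¹ = tc` and all conjugates in `{t, tc}`; `a ∈ C(t)` with `a² ∉ {1, t, c, tc}`.  Then `a` has order `8`,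
`a⁴ = c`, `C(t) = ⟨a⟩ × ⟨t⟩ ∌ x`, `x a = a^μ x`, `x t = a⁴ t x`, `x² = a^σ t^τ` with `(μ, σ, τ)` admissible.
[cite: Rotman1995, Ch. 4 Ex. 4.4 and Cor. 5.45] -/
theorem ia8_normal_form (hcard : Nat.card G = 32) {t c x a : G} (hcc : c * c = 1) (hc1 : c ≠ 1)
    (hcen : ∀ g : G, c * g = g * c) (huci : ∀ s : G, s * s = 1 → (∀ g : G, g * s = s * g) → s = 1 ∨ s = c)
    (hp4 : ∀ g : G, g ^ 4 = 1 ∨ g ^ 4 = c) (hxt : x * t * x⁻¹ = t * c)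
    (hconj : ∀ g : G, g * t * g⁻¹ = t ∨ g * t * g⁻¹ = t * c) (htt : t * t = 1) (ht1 : t ≠ 1) (htne : t ≠ c)
    (hat : a * t = t * a) (hsq : a * a ≠ 1 ∧ a * a ≠ t ∧ a * a ≠ c ∧ a * a ≠ t * c) :
    ∃ (μ σ : ZMod 8) (τ : ZMod 2), orderOf a = 8 ∧ a ^ 4 = c ∧ t * a = a * t ∧ t ∉ Subgroup.zpowers a ∧
      (∀ i j : ℕ, x ≠ a ^ i * t ^ j) ∧ x * a = a ^ μ.val * x ∧ x * t = a ^ 4 * t * x ∧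
      x * x = a ^ σ.val * t ^ τ.val ∧
      (μ, σ, τ) ∈ ([(1, 0, 0), (1, 1, 0), (1, 2, 0), (1, 3, 0), (1, 4, 0), (1, 5, 0), (1, 6, 0), (1, 7, 0), (3, 0, 0), (3, 2, 1),
        (3, 4, 0), (3, 6, 1), (5, 0, 0), (5, 1, 1), (5, 2, 0), (5, 3, 1), (5, 4, 0), (5, 5, 1), (5, 6, 0), (5, 7, 1), (7, 0, 0),
        (7, 2, 1), (7, 4, 0), (7, 6, 1)] : List (ZMod 8 × ZMod 8 × ZMod 2)) := by
  classical
  have ha4 : a ^ 4 = c := pow_four_eq_of_sq_not_mem hcard hcc hc1 hcen huci hp4 hxt hconj htt ht1 htne hat hsq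
  have ha8 : a ^ 8 = 1 := by rw [show (8 : ℕ) = 4 + 4 from rfl, pow_add, ha4, hcc]
  haveI : Fact (Nat.Prime 2) := ⟨Nat.prime_two⟩
  have ha : orderOf a = 8 := by
    have h1 : ¬ a ^ 2 ^ 2 = 1 := by rw [show (2 : ℕ) ^ 2 = 4 by norm_num, ha4]; exact hc1
    have h2 : a ^ 2 ^ (2 + 1) = 1 := by simpa using ha8
    simpa using orderOf_eq_prime_pow h1 h2
  have ht4 : t ≠ a ^ 4 := by rw [ha4]; exact htne
  have hta : t ∉ Subgroup.zpowers a := not_mem_zpowers_of_involution ha htt ht1 ht4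
  have henum := exists_word_eight hcard hc1 hxt hconj htt ht1 ha ht4 hat
  have hxt' : x * t = t * c * x := by rw [← hxt]; group
  -- `x ∉ C(t)`
  have hxC : ∀ i j : ℕ, x ≠ a ^ i * t ^ j := by
    intro i j h
    have hcomm : x * t = t * x := by
      rw [h]; exact (((show Commute t a from hat.symm).pow_right _).mul_right ((Commute.refl t).pow_right _)).eq.symm
    rw [hcomm] at hxt'
    have : t * x = t * (c * x) := by rw [← mul_assoc]; exact hxt'
    exact hc1 (mul_right_cancel ((mul_left_cancel this).symm.trans (one_mul x).symm))
  -- `x a x⁻¹ = aⁱ tʲ`, `x² = a^σ t^τ`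
  obtain ⟨i, j, hi8, hj2, hij⟩ := henum _ (conj_comm_of_comm (x := x) hcen hconj hat)
  obtain ⟨s, r, hs8, hr2, hsr⟩ := henum _ (sq_comm_of_conj hcc hcen hxt)
  have hxa : x * a = a ^ i * t ^ j * x := by rw [← hij]; group
  -- `i` is odd: `(x a x⁻¹)⁴ = x c x⁻¹ = c = a⁴`, `(aⁱ tʲ)⁴ = a^{4i}`
  have hct : Commute (a ^ i) (t ^ j) := (show Commute a t from hat).pow_pow i j
  have htj : ∀ n : ℕ, (t ^ j) ^ (2 * n) = 1 := fun n => by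
    rw [← pow_mul, mul_left_comm, pow_mul, pow_two, htt, one_pow]
  have hiodd : i % 2 = 1 := by
    have h1 : (x * a * x⁻¹) ^ 4 = a ^ 4 := by rw [conj_pow, ha4, ← hcen x]; group
    rw [hij, hct.mul_pow, show (4 : ℕ) = 2 * 2 from rfl, htj, mul_one, ← pow_mul, pow_eq_pow_iff_mod ha] at h1
    omega
  -- `j = 0`: `x²` centralises `a`, and `θ²(a) = a^{i²+4j} t^{j(i+1)}`
  have hj0 : j = 0 := by
    by_contra hj1
    have hj1 : j = 1 := by omega
    subst hj1
    rw [pow_one] at hij hxa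
    -- `x (x a x⁻¹) x⁻¹ = a` since `x² ∈ C(t) = ⟨a⟩ × ⟨t⟩` commutes with `a`
    have h2 : x * x * a = a * (x * x) := by
      rw [hsr]; exact (((Commute.refl a).pow_left _).mul_left ((show Commute t a from hat.symm).pow_left _)).eq
    have h3 : x * (a ^ i * t) * x⁻¹ = a := by
      rw [← hij]
      calc x * (x * a * x⁻¹) * x⁻¹ = (x * x) * a * (x * x)⁻¹ := by group
        _ = a := by rw [h2]; group
    -- but `x (aⁱ t) x⁻¹ = (aⁱ t)ⁱ (t c) = a^{i·i} tⁱ t c`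
    have h4 : x * (a ^ i * t) * x⁻¹ = (a ^ i * t) ^ i * (t * c) := by
      rw [show x * (a ^ i * t) * x⁻¹ = (x * a * x⁻¹) ^ i * (x * t * x⁻¹) by rw [conj_pow]; group, hij, hxt]
    rw [h4, ((show Commute a t from hat).pow_left i).mul_pow, ← pow_mul] at h3
    -- `tⁱ = t` (i odd); so `a^{i i} * t * (t * c) = a^{i i} * c = a`: then `a^{i i + 4} = a`, `i i + 4 ≡ 1`, impossible
    obtain ⟨r', hr'⟩ : ∃ r', i = 2 * r' + 1 := ⟨i / 2, by omega⟩
    have hti : t ^ i = t := by rw [hr', pow_add, pow_mul, pow_two, htt, one_pow, one_mul, pow_one]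
    rw [hti, show a ^ (i * i) * t * (t * c) = a ^ (i * i) * (t * t) * c by group, htt, mul_one, ← ha4, ← pow_add] at h3
    nth_rewrite 2 [← pow_one a] at h3
    rw [pow_eq_pow_iff_mod ha] at h3
    have : (i * i) % 8 = 1 := by
      have hi : i % 8 = 1 ∨ i % 8 = 3 ∨ i % 8 = 5 ∨ i % 8 = 7 := by omega
      rcases hi with h | h | h | h <;> simp [Nat.mul_mod, h]
    omega
  subst hj0
  rw [pow_zero, mul_one] at hij hxa
  -- the parameters
  refine ⟨(i : ZMod 8), (s : ZMod 8), (r : ZMod 2), ha, ha4, hat.symm, hta, hxC, ?_, ?_, ?_, ?_⟩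
  · rw [ZMod.val_natCast, Nat.mod_eq_of_lt hi8]; exact hxa
  · rw [hxt', ha4, hcen t]
  · rw [ZMod.val_natCast, ZMod.val_natCast, Nat.mod_eq_of_lt hs8, Nat.mod_eq_of_lt hr2]; exact hsr
  · apply c8c2_admissible_of_eq
    · -- `4 i ≡ 4 (mod 8)`
      have h : ((4 * i : ℕ) : ZMod 8) = ((4 : ℕ) : ZMod 8) := by
        rw [ZMod.natCast_eq_natCast_iff']; omega
      push_cast at h
      exact h
    · -- `x x² x⁻¹ = x²`: `a^{i s} (t c)^r = a^s t^r`
      have h1 : x * (a ^ s * t ^ r) * x⁻¹ = a ^ s * t ^ r := by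
        rw [← hsr]; group
      have h2 : x * (a ^ s * t ^ r) * x⁻¹ = a ^ (i * s + 4 * r) * t ^ r := by
        calc x * (a ^ s * t ^ r) * x⁻¹ = (x * a * x⁻¹) ^ s * (x * t * x⁻¹) ^ r := by rw [conj_pow, conj_pow]; group
          _ = (a ^ i) ^ s * (t * c) ^ r := by rw [hij, hxt]
          _ = a ^ (i * s) * (t ^ r * (a ^ 4) ^ r) := by rw [← pow_mul, (show Commute t c from (hcen t).symm).mul_pow, ← ha4]
          _ = a ^ (i * s) * (a ^ (4 * r) * t ^ r) := by rw [← pow_mul, ((show Commute t a from hat.symm).pow_pow _ _).eq]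
          _ = a ^ (i * s + 4 * r) * t ^ r := by rw [pow_add, mul_assoc]
      rw [h2] at h1
      have h3 : a ^ (i * s + 4 * r) = a ^ s := by
        have := congrArg (· * (t ^ r)⁻¹) h1
        simpa using this
      rw [pow_eq_pow_iff_mod ha] at h3
      have h4 : ((i * s + 4 * r : ℕ) : ZMod 8) = ((s : ℕ) : ZMod 8) := by
        rw [ZMod.natCast_eq_natCast_iff']; exact h3
      push_cast at h4
      rw [ZMod.val_natCast, Nat.mod_eq_of_lt hr2]
      exact h4

end Summit.HodgeConjecture.CorCM.GaloisModels.CaseA
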